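import Literature.Analysis.FluidPDE.PlanarTypedElements
import HarnessLib

/-!
# Typed elements, second layer: runs, diagonal graph bands, and SHEARED diagonal graph bands

Topic `Literature/Analysis/FluidPDE`. The typed elements `ElemQ` of `PlanarTypedElements.lean` are
runs and diagonal graph bands; the sheared diagonal graph bands `SDgQ` (same file; kinematics in
`PlanarShearedCornerElement.lean`) are adjoined here through the WRAPPER type
`ElemQ2 := base ElemQ | sdg SDgQ`, so that every landed statement about `ElemQ` is reused verbatim
on the `base` arm and only the `sdg` arm is new. This file: the element API of `ElemQ2` (scalar,
stream function, band, validity; smoothness, transport by the perpendicular gradient of the stream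
function, bound, closed band, band containment), each by delegation.

Folklore; no named facts. Infrastructure towards a discharge of `acm_compatible_blocks`
(`QuasiSelfSimilarCompatibleBlocks.lean`).

## References

* G. Alberti, G. Crippa, A. L. Mazzucato, *Exponential self-similar mixing by incompressible
  flows*, J. Amer. Math. Soc. 32 (2019), 445–490, §7 (arXiv:1605.02090).
-/

noncomputable section

open Function Set Filter
open scoped Topology ContDiff

namespace Literature.Analysis.FluidPDE

namespace PlanarKinematics

/-- The plane `ℝ²` as a Euclidean space. [folklore] -/
local notation "E²" => EuclideanSpace ℝ (Fin 2)

/-! ## A sheared band is its underlying diagonal band where the material slope is locally constant -/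

namespace Pw

variable {F : Pw} {t₀ τ : ℝ}

/-- A static profile has vanishing clock derivative data `dα`. [folklore] -/
theorem dα_static (h : F.staticB = true) (α u : ℝ) : F.dα α u = 0 := by
  simp only [staticB, Bool.and_eq_true, decide_eq_true_eq, List.all_eq_true] at h
  obtain ⟨⟨hc, hs⟩, hk⟩ := h
  have hsum : (F.kinks.map fun k => k.dα α u).sum = 0 := by
    rw [List.sum_eq_zero]
    intro x hx
    obtain ⟨k, hk', rfl⟩ := List.mem_map.1 hx
    obtain ⟨hb, hJ⟩ := hk k hk'
    simp [Kink.dα, Aff.rate, hb, hJ]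
  simp [Pw.dα, Aff.rate, hc, hs, hsum]

/-- A static profile has vanishing `dαPrim`. [folklore] -/
theorem dαPrim_static (h : F.staticB = true) (α u : ℝ) : F.dαPrim α u = 0 := by
  simp only [staticB, Bool.and_eq_true, decide_eq_true_eq, List.all_eq_true] at h
  obtain ⟨⟨hc, hs⟩, hk⟩ := h
  have hsum : (F.kinks.map fun k => k.dαPrim α u).sum = 0 := by
    rw [List.sum_eq_zero]
    intro x hx
    obtain ⟨k, hk', rfl⟩ := List.mem_map.1 hx
    obtain ⟨hb, hJ⟩ := hk k hk'
    simp [Kink.dαPrim, Aff.rate, hb, hJ]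
  simp [Pw.dαPrim, Aff.rate, hc, hs, hsum]

/-- Clocked time derivative of a static profile. [folklore] -/
theorem cdt_static (h : F.staticB = true) (t u : ℝ) : F.cdt t₀ τ t u = 0 := by
  simp [Pw.cdt, dα_static h]

/-- Clocked antiderivative datum of a static profile. [folklore] -/
theorem cprim_static (h : F.staticB = true) (t u : ℝ) : F.cprim t₀ τ t u = 0 := by
  simp [Pw.cprim, dαPrim_static h]

end Pw

namespace SDgQ

variable {e : SDgQ} {t₀ τ : ℝ}

/-- **The sheared scalar is the diagonal-band scalar of its data wherever the material slope at the
sheared abscissa equals that at the frame abscissa** (e.g. both in one gap of `Ξ`). [folklore] -/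
theorem scalar_eq_dScalar (hv : e.validB = true) (G : ℝ → ℝ) {t : ℝ} {z : E²}
    (hξ : e.d.Ξ.cdu t₀ τ t (shAbscissa (e.sh : ℝ) e.Tf (diagFrame ((d4Frame e.d.o).app z))) =
      e.d.Ξ.cdu t₀ τ t ((diagFrame ((d4Frame e.d.o).app z)) 0)) :
    e.scalar t₀ τ G t z = e.d.scalar t₀ τ G t z := by
  rw [scalar, DgQ.scalar, LinFrame.conjScalar_apply, LinFrame.conjScalar_apply, shCornerScalar, cornerScalar,
    shGraphPullback_apply, graphPullback_apply, vec2_apply_one, vec2_apply_one, hξ, cval_T_eq_Tf hv]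

/-- **The sheared stream function is the diagonal-band stream function of its data wherever the axial
rate at the sheared abscissa equals that at the frame abscissa** (the profile being static, the
antiderivative datum vanishes). [folklore] -/
theorem stream_eq_dStream (hv : e.validB = true) {t : ℝ} {z : E²}
    (hg : e.d.g t₀ τ t (shAbscissa (e.sh : ℝ) e.Tf (diagFrame ((d4Frame e.d.o).app z))) =
      e.d.g t₀ τ t ((diagFrame ((d4Frame e.d.o).app z)) 0)) :
    e.stream t₀ τ t z = e.d.stream t₀ τ t z := by
  have hs := static_of_validB hv
  simp only [stream, DgQ.stream, LinFrame.conjStream_apply, shCornerStream, cornerStream, shGraphStream_apply,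
    graphStream_apply, hg, Pw.cprim_static hs, sub_zero]
  rw [cval_T_eq_Tf hv]

/-- **In a gap, the slope at the sheared abscissa is the slope at the frame abscissa**: if the clocked
slope of `Ξ` is constant on `[u - μ, u + μ]` and `|sh| · |v - T(u)| ≤ μ`. [folklore] -/
theorem cdu_shAbscissa_eq {t u μ : ℝ} {w : E²} (hu : w 0 = u)
    (hW : ∀ u' ∈ Icc (u - μ) (u + μ), e.d.Ξ.cdu t₀ τ t u' = e.d.Ξ.cdu t₀ τ t u)
    (hμ : |(e.sh : ℝ)| * |w 1 - e.Tf (w 0)| ≤ μ) :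
    e.d.Ξ.cdu t₀ τ t (shAbscissa (e.sh : ℝ) e.Tf w) = e.d.Ξ.cdu t₀ τ t (w 0) := by
  rw [hu]
  refine hW _ ?_
  rw [shAbscissa_apply, hu]
  have hb : |(e.sh : ℝ) * (w 1 - e.Tf u)| ≤ μ := by rw [abs_mul]; rw [hu] at hμ; exact hμ
  constructor <;> nlinarith [abs_le.1 hb]

/-- The same for the axial rate. [folklore] -/
theorem g_shAbscissa_eq {t u μ : ℝ} {w : E²} (hu : w 0 = u)
    (hW : ∀ u' ∈ Icc (u - μ) (u + μ), e.d.g t₀ τ t u' = e.d.g t₀ τ t u)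
    (hμ : |(e.sh : ℝ)| * |w 1 - e.Tf (w 0)| ≤ μ) :
    e.d.g t₀ τ t (shAbscissa (e.sh : ℝ) e.Tf w) = e.d.g t₀ τ t (w 0) := by
  rw [hu]
  refine hW _ ?_
  rw [shAbscissa_apply, hu]
  have hb : |(e.sh : ℝ) * (w 1 - e.Tf u)| ≤ μ := by rw [abs_mul]; rw [hu] at hμ; exact hμ
  constructor <;> nlinarith [abs_le.1 hb]

/-- **Off the loose band both scalars vanish**: if `G` vanishes off `(-r₀, r₀)` and
`r₀ · whi ≤ |v - T(u)|`, then the sheared scalar and the diagonal-band scalar of its data are both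
zero (the slope is at most `whi` everywhere). [folklore] -/
theorem scalar_eq_zero_of_far (hv : e.validB = true) {G : ℝ → ℝ} {r₀ : ℝ} (hG0 : ∀ q, G q ≠ 0 → |q| < r₀) (hr : 0 ≤ r₀)
    {t : ℝ} {z : E²}
    (hfar : r₀ * e.d.whi ≤ |(diagFrame ((d4Frame e.d.o).app z)) 1 - e.Tf ((diagFrame ((d4Frame e.d.o).app z)) 0)|) :
    e.scalar t₀ τ G t z = 0 ∧ e.d.scalar t₀ τ G t z = 0 := by
  have hm := DgQ.matValid_of_validB (validD_of_validB hv)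
  set w := diagFrame ((d4Frame e.d.o).app z) with hw
  have key : ∀ a : ℝ, e.d.Ξ.cdu t₀ τ t a ≤ e.d.whi → 0 < e.d.Ξ.cdu t₀ τ t a →
      G ((w 1 - e.Tf (w 0)) / e.d.Ξ.cdu t₀ τ t a) = 0 := by
    intro a hle hpos
    by_contra hne
    have hq := hG0 _ hne
    rw [abs_div, abs_of_pos hpos, div_lt_iff₀ hpos] at hq
    have : r₀ * e.d.Ξ.cdu t₀ τ t a ≤ r₀ * e.d.whi := mul_le_mul_of_nonneg_left hle hr
    linarith
  constructor
  · rw [scalar, LinFrame.conjScalar_apply, shCornerScalar, shGraphPullback_apply, vec2_apply_one]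
    exact key _ (Pw.cdu_mem_Icc (t₀ := t₀) (τ := τ) hm t _).2 (Pw.cdu_pos (t₀ := t₀) (τ := τ) hm t _)
  · rw [DgQ.scalar, LinFrame.conjScalar_apply, cornerScalar, graphPullback_apply, vec2_apply_one, cval_T_eq_Tf hv]
    exact key _ (Pw.cdu_mem_Icc (t₀ := t₀) (τ := τ) hm t _).2 (Pw.cdu_pos (t₀ := t₀) (τ := τ) hm t _)

end SDgQ

/-- **A typed element of the second layer**: an element of the first layer (run or diagonal graph
band), or a sheared diagonal graph band. [folklore] -/
inductive ElemQ2
  /-- a run or a diagonal graph band -/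
  | base (e : ElemQ)
  /-- a sheared diagonal graph band -/
  | sdg (s : SDgQ)
deriving DecidableEq, Inhabited

namespace ElemQ2

variable (e : ElemQ2) (t₀ τ : ℝ)

/-- Scalar of an element. [folklore] -/
def scalar (G : ℝ → ℝ) : ℝ → E² → ℝ :=
  match e with
  | base b => b.scalar t₀ τ G
  | sdg s => s.scalar t₀ τ G

/-- Stream function of an element. [folklore] -/
def stream : ℝ → E² → ℝ :=
  match e with
  | base b => b.stream t₀ τ
  | sdg s => s.stream t₀ τ

/-- Band of an element. [folklore] -/
def band (e : ElemQ2) (t₀ τ r₀ : ℝ) : Set (ℝ × E²) :=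
  match e with
  | base b => b.band t₀ τ r₀
  | sdg s => s.band t₀ τ r₀

/-- Validity test of an element. [folklore] -/
def validB (e : ElemQ2) : Bool :=
  match e with
  | base b => b.validB
  | sdg s => s.validB

/-- The underlying first-layer element: itself, or the diagonal graph band of the sheared datum (same
orientation, profile, material map, bounds, offsets — the GEOMETRY of a sheared band is that of its
data; only the scalar's material abscissa differs). [folklore] -/
def toElemQ : ElemQ2 → ElemQ
  | base b => b
  | sdg s => .dg s.d

/-- Is the element sheared? [folklore] -/
def isSheared : ElemQ2 → Bool
  | base _ => false
  | sdg _ => true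

/-- **Geometric proxy** of an element: itself, or the proxy diagonal graph band of the sheared datum
(same frame, profile and bounds, constant material slope `whi`): every geometric statement of
`PlanarBandPieces.lean` / `PlanarChainChecks.lean` is read on the proxy. [folklore] -/
def geo : ElemQ2 → ElemQ
  | base b => b
  | sdg s => .dg s.geoDg

/-- Unfolding / bookkeeping lemma. [folklore] -/
@[simp] theorem scalar_base (b : ElemQ) (G : ℝ → ℝ) : (base b).scalar t₀ τ G = b.scalar t₀ τ G := rfl
/-- Unfolding / bookkeeping lemma. [folklore] -/
@[simp] theorem scalar_sdg (s : SDgQ) (G : ℝ → ℝ) : (sdg s).scalar t₀ τ G = s.scalar t₀ τ G := rfl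
/-- Unfolding / bookkeeping lemma. [folklore] -/
@[simp] theorem stream_base (b : ElemQ) : (base b).stream t₀ τ = b.stream t₀ τ := rfl
/-- Unfolding / bookkeeping lemma. [folklore] -/
@[simp] theorem stream_sdg (s : SDgQ) : (sdg s).stream t₀ τ = s.stream t₀ τ := rfl
/-- Unfolding / bookkeeping lemma. [folklore] -/
@[simp] theorem band_base (b : ElemQ) (r₀ : ℝ) : (base b).band t₀ τ r₀ = b.band t₀ τ r₀ := rfl
/-- Unfolding / bookkeeping lemma. [folklore] -/
@[simp] theorem band_sdg (s : SDgQ) (r₀ : ℝ) : (sdg s).band t₀ τ r₀ = s.band t₀ τ r₀ := rfl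
/-- Unfolding / bookkeeping lemma. [folklore] -/
@[simp] theorem validB_base (b : ElemQ) : (base b).validB = b.validB := rfl
/-- Unfolding / bookkeeping lemma. [folklore] -/
@[simp] theorem validB_sdg (s : SDgQ) : (sdg s).validB = s.validB := rfl
/-- Unfolding / bookkeeping lemma. [folklore] -/
@[simp] theorem toElemQ_base (b : ElemQ) : (base b).toElemQ = b := rfl
/-- Unfolding / bookkeeping lemma. [folklore] -/
@[simp] theorem toElemQ_sdg (s : SDgQ) : (sdg s).toElemQ = .dg s.d := rfl
/-- Unfolding / bookkeeping lemma. [folklore] -/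
@[simp] theorem geo_base (b : ElemQ) : (base b).geo = b := rfl
/-- Unfolding / bookkeeping lemma. [folklore] -/
@[simp] theorem geo_sdg (s : SDgQ) : (sdg s).geo = .dg s.geoDg := rfl

variable {e t₀ τ}

/-- Validity of a sheared element gives validity of its underlying diagonal graph band. [folklore] -/
theorem validB_toElemQ (hv : e.validB = true) : e.toElemQ.validB = true := by
  cases e with
  | base b => exact hv
  | sdg s => exact SDgQ.validD_of_validB hv

/-- Validity gives validity of the geometric proxy. [folklore] -/
theorem validB_geo (hv : e.validB = true) : e.geo.validB = true := by
  cases e with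
  | base b => exact hv
  | sdg s => exact SDgQ.geoDg_validB_of_validB hv

/-- **The band of an element is the band of its geometric proxy.** [folklore] -/
theorem band_eq_geo_band (r₀ : ℝ) : e.band t₀ τ r₀ = e.geo.band t₀ τ r₀ := by
  cases e with
  | base b => rfl
  | sdg s => rfl

/-- **Smooth scalar.** [folklore] -/
theorem contDiff_uncurry_scalar {G : ℝ → ℝ} (hG : ContDiff ℝ ∞ G) (hv : e.validB = true) :
    ContDiff ℝ ∞ (uncurry (e.scalar t₀ τ G)) := by
  cases e with
  | base b => exact ElemQ.contDiff_uncurry_scalar hG hv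
  | sdg s => exact SDgQ.contDiff_uncurry_scalar hG hv

/-- **Smooth stream function.** [folklore] -/
theorem contDiff_uncurry_stream (hτ : τ ≠ 0) (hv : e.validB = true) : ContDiff ℝ ∞ (uncurry (e.stream t₀ τ)) := by
  cases e with
  | base b => exact ElemQ.contDiff_uncurry_stream hτ hv
  | sdg s => exact SDgQ.contDiff_uncurry_stream hτ hv

/-- **Transport by the perpendicular gradient of the stream function, everywhere.** [folklore] -/
theorem transport {G : ℝ → ℝ} (hG : ContDiff ℝ ∞ G) (hτ : τ ≠ 0) (hv : e.validB = true) (t : ℝ) (z : E²) :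
    deriv (fun s => e.scalar t₀ τ G s z) t + fderiv ℝ (e.scalar t₀ τ G t) z (perpGrad (e.stream t₀ τ t) z) = 0 := by
  cases e with
  | base b => exact ElemQ.transport hG hτ hv t z
  | sdg s => exact SDgQ.transport hG hτ hv t z

/-- **Bound.** [folklore] -/
theorem abs_scalar_le {G : ℝ → ℝ} {M : ℝ} (hM : ∀ q, |G q| ≤ M) (t : ℝ) (z : E²) : |e.scalar t₀ τ G t z| ≤ M := by
  cases e with
  | base b => exact ElemQ.abs_scalar_le hM t z
  | sdg s => exact SDgQ.abs_scalar_le hM t z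

/-- **Closed band.** [folklore] -/
theorem isClosed_band (r₀ : ℝ) : IsClosed (e.band t₀ τ r₀) := by
  cases e with
  | base b => exact ElemQ.isClosed_band r₀
  | sdg s => exact SDgQ.isClosed_band r₀

/-- **Band containment.** [folklore] -/
theorem mem_band_of_scalar_ne_zero {G : ℝ → ℝ} {r₀ : ℝ} (hG0 : ∀ q, G q ≠ 0 → |q| < r₀) (hv : e.validB = true)
    {p : ℝ × E²} (hne : e.scalar t₀ τ G p.1 p.2 ≠ 0) : p ∈ e.band t₀ τ r₀ := by
  cases e with
  | base b => exact ElemQ.mem_band_of_scalar_ne_zero hG0 hv hne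
  | sdg s => exact SDgQ.mem_band_of_scalar_ne_zero hG0 hv hne

end ElemQ2

end PlanarKinematics

end Literature.Analysis.FluidPDE
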